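import Literature.AnabelianGeometry.AbsoluteAnabelian.AbsTopIII.KummerFaithfulSectionReductionProofs
import Literature.AnabelianGeometry.AbsoluteAnabelian.AbsTopIII.KummerFaithfulCurveDedekindProofs
import Literature.AnabelianGeometry.AbsoluteAnabelian.AbsTopIII.KummerFaithfulProperGroupSchemePointsProofs
import Literature.NumberTheory.EllipticCurves.NeronModelExistenceProofs
import Literature.NumberTheory.EllipticCurves.NeronModelAbelianSchemeProofs
import Mathlib.RingTheory.Localization.Away.Basic
import HarnessLib

/-!
# [AbsTopIII] Rmk. 1.5.4 (i) for function fields of CURVES over `ℚ_p`: Def. 1.5 (a) for abelian varieties over finite extensions of `ℚ_p(t)`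

Proof-only companion (no new definitions) to `AbsTopIII/KummerFaithful.lean` (S. Mochizuki, *Topics in
Absolute Anabelian Geometry III*, §1, Def. 1.5 (a) p. 32, Rmk. 1.5.4 (i) p. 33, lit key
`paper:url-5493eb38cbb7`): "every sub-`p`-adic field `k` [...] is Kummer-faithful [...]. Indeed, to
verify this, one reduces immediately, by base-change, to the case where `k` is a finitely generated
extension of an MLF [...]. Then by restricting to various closed points of this variety, one reduces to
the case where `k` itself is an MLF."

**The transcendence-degree-ONE case of the closed-point argument, kernel-checked** (assembly of the
route of record HOME/staging/f/f-083/g2/F0369-FG-ROUTE.md, junctions J-a/J-c/J-d + base case):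

* `divisibleElementsTrivial_points_of_finite_ratFunc_padic` — for every field `L` finite over
  `ℚ_p(t) = RatFunc ℚ_[p]` and every abelian variety `A / L`, `⋂_{N ≥ 1} N · A(L) = {0}`
  (condition (a) of Def. 1.5).

Proof (p. 33 made explicit): `R :=` the integral closure of `ℚ_p[t]` in `L` is a Dedekind domain with
fraction field `L`, infinitely many maximal ideals and residue fields finite over `ℚ_p`
(`KummerFaithfulCurveDedekindProofs`); `A` spreads out to a proper smooth group scheme `𝒜` over a
localisation `R[1/f]` (tree `exists_abelianScheme_away_holds`), which is the Néron model of `A`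
(`isNeronModel_of_isProper_of_smooth`), so `A(L) = 𝒜(R[1/f])` multiplicatively and a divisible point is
a divisible section (`KummerFaithfulNeronSectionsProofs`); at each of the infinitely many maximal ideals
`𝔪 ∌ f` of `R` the reduction `𝒜(R[1/f]) → 𝒜_𝔪(R/𝔪)` is a group homomorphism into the points of a
PROPER GROUP SCHEME OVER THE MLF `R/𝔪`, which has no divisible elements
(`KummerFaithfulProperGroupSchemePointsProofs`, via compactness + total disconnectedness of the strong
topology), so the section agrees with the unit section on infinitely many closed points and is the unit
section (`KummerFaithfulSectionReductionProofs`, `KummerFaithfulDedekindSectionsProofs`).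

HONEST FRAMING: this is the FIRST positive-transcendence-degree case of FACT-LIST row F-0369
(`Rmk_1_5_4_i`); the general finitely generated case (transcendence degree `≥ 2`) additionally needs the
geometric integrality of the special fibres (Zariski connectedness over Dedekind bases essentially of
finite type over `ℚ_p`) to iterate — NOT done here.  Nothing here bears on [IUTchIII] Cor. 3.12; typed
≠ discharged.
-/

noncomputable section

open _root_.CategoryTheory _root_.CategoryTheory.Limits _root_.AlgebraicGeometry
open scoped _root_.CategoryTheory.MonObj _root_.CategoryTheory.Obj MonoidalCategory Classical Polynomial

namespace Literature.AnabelianGeometry.AbsoluteAnabelian.AbsTopIII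

open Polynomial Literature.AlgebraicGeometry.Motives Literature.NumberTheory.EllipticCurves

/-- `ℚ_p` is infinite (characteristic zero). Routine. [cite: MochizukiAbsTopIII2015, Rmk 1.5.4 (i) p.33] -/
theorem infinite_padic (p : ℕ) [Fact p.Prime] : Infinite ℚ_[p] :=
  Infinite.of_injective ((↑) : ℕ → ℚ_[p]) Nat.cast_injective

/-- **Condition (a) of Def. 1.5 for abelian varieties over the fraction field of a "`p`-adic curve"**:
let `R` be a Dedekind domain which is a `ℚ_p`-algebra with infinitely many maximal ideals, all of whose
residue fields are finite over `ℚ_p` (e.g. the integral closure of `ℚ_p[t]` in a finite extension of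
`ℚ_p(t)`), and `L = Frac R`.  Then every abelian variety `A / L` satisfies `⋂_{N ≥ 1} N · A(L) = {0}`.
The printed "restricting to various closed points of this variety" ([AbsTopIII] Rmk. 1.5.4 (i) p. 33):
spread `A` out to a proper smooth group scheme over `R[1/f]` (its Néron model), turn a divisible point
into a divisible section, reduce at the infinitely many closed points with `f ≠ 0` — proper group
schemes over MLF's have no divisible points — and conclude that the section is the unit section.
[cite: MochizukiAbsTopIII2015, Rmk 1.5.4 (i) p.33] -/
theorem divisibleElementsTrivial_points_of_dedekind_padic (p : ℕ) [Fact p.Prime] (R : Type) [CommRing R]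
    [IsDedekindDomain R] [Algebra ℚ_[p] R] (L : Type) [Field L] [Algebra R L] [IsFractionRing R L]
    (hinf : {𝔪 : Ideal R | 𝔪.IsMaximal}.Infinite)
    (hfin : ∀ 𝔪 : Ideal R, 𝔪.IsMaximal → Module.Finite ℚ_[p] (R ⧸ 𝔪))
    (A : AbelianVariety L) : DivisibleElementsTrivial (A.Points L) := by
  -- (2) spread `A` out to a proper smooth group scheme over some `R[1/f]`
  obtain ⟨f, hf0, hf⟩ := exists_abelianScheme_away_holds R L A.X
  have hfL : IsUnit (algebraMap R L f) := by
    rw [isUnit_iff_ne_zero, map_ne_zero_iff _ (IsFractionRing.injective R L)]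
    exact hf0
  letI : Algebra (Localization.Away f) L := (IsLocalization.Away.lift f hfL).toAlgebra
  haveI : IsScalarTower R (Localization.Away f) L :=
    IsScalarTower.of_algebraMap_eq fun r => (IsLocalization.Away.lift_eq f hfL r).symm
  obtain ⟨𝒜, hprop, hsm, e, he⟩ := hf (Localization.Away f)
  -- (3) `R[1/f]` is Dedekind with fraction field `L`; `𝒜` is the Néron model of `A`
  have hfpow : Submonoid.powers f ≤ nonZeroDivisors R := powers_le_nonZeroDivisors_of_noZeroDivisors hf0
  haveI : IsDomain (Localization.Away f) := IsLocalization.isDomain_localization hfpow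
  haveI : IsDedekindDomain (Localization.Away f) :=
    IsLocalization.isDedekindDomain R hfpow (Localization.Away f)
  haveI : IsFractionRing (Localization.Away f) L :=
    IsFractionRing.isFractionRing_of_isDomain_of_isLocalization (Submonoid.powers f)
      (Localization.Away f) L
  haveI := hprop
  haveI := hsm
  haveI := he
  have hN : IsNeronModel (Localization.Away f) L 𝒜.X A.X :=
    (isNeronModel_of_isProper_of_smooth (Localization.Away f) L 𝒜.X).of_iso_right e
  haveI : IsSeparated 𝒜.X.hom := hN.isSeparated
  -- (4) divisible points are divisible sections; it suffices to kill divisible sections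
  refine IsNeronModel.divisibleElementsTrivial_points_of_sections A hN fun s hs => ?_
  -- (5) the closed points `𝔪 ∌ f` of the curve, their residue fields `R ⧸ 𝔪` (finite over `ℚ_p`) and
  --     the field points `Spec (R ⧸ 𝔪) → Spec R[1/f]`
  have hunit : ∀ 𝔪 : {𝔪 : Ideal R // 𝔪.IsMaximal ∧ f ∉ 𝔪},
      IsUnit (Ideal.Quotient.mk 𝔪.1 f) := by
    intro 𝔪
    haveI : 𝔪.1.IsMaximal := 𝔪.2.1
    letI : Field (R ⧸ 𝔪.1) := Ideal.Quotient.field 𝔪.1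
    rw [isUnit_iff_ne_zero, Ne, Ideal.Quotient.eq_zero_iff_mem]
    exact 𝔪.2.2
  -- the point of `Spec R[1/f]` below `𝔪`: the kernel of `R[1/f] → R ⧸ 𝔪`
  let pt : {𝔪 : Ideal R // 𝔪.IsMaximal ∧ f ∉ 𝔪} → Spec (.of (Localization.Away f)) := fun 𝔪 =>
    ⟨RingHom.ker (IsLocalization.Away.lift f (hunit 𝔪)), by
      haveI : 𝔪.1.IsMaximal := 𝔪.2.1
      exact RingHom.ker_isPrime _⟩
  have hpt : ∀ 𝔪, (pt 𝔪).asIdeal.comap (algebraMap R (Localization.Away f)) = 𝔪.1 := by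
    intro 𝔪
    change (RingHom.ker (IsLocalization.Away.lift f (hunit 𝔪))).comap _ = _
    rw [RingHom.comap_ker, IsLocalization.Away.lift_comp, Ideal.mk_ker]
  have hpt_inj : Function.Injective pt := by
    intro 𝔪 𝔪' h
    apply Subtype.ext
    rw [← hpt 𝔪, ← hpt 𝔪', h]
  -- infinitely many such closed points
  have h3 : {𝔪 : Ideal R | 𝔪.IsMaximal ∧ f ∉ 𝔪}.Infinite := by
    have h2 : {𝔪 : Ideal R | 𝔪.IsMaximal ∧ f ∈ 𝔪}.Finite := by
      have hV := PrimeSpectrum.finite_zeroLocus_of_ne_bot (A := R) (I := Ideal.span {f})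
        (by rwa [Ne, Ideal.span_singleton_eq_bot])
      refine (hV.image PrimeSpectrum.asIdeal).subset fun 𝔪 h𝔪 => ?_
      refine ⟨⟨𝔪, h𝔪.1.isPrime⟩, ?_, rfl⟩
      rw [PrimeSpectrum.mem_zeroLocus, SetLike.coe_subset_coe, Ideal.span_singleton_le_iff_mem]
      exact h𝔪.2
    have hsub : {𝔪 : Ideal R | 𝔪.IsMaximal} ⊆
        {𝔪 : Ideal R | 𝔪.IsMaximal ∧ f ∈ 𝔪} ∪ {𝔪 : Ideal R | 𝔪.IsMaximal ∧ f ∉ 𝔪} := by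
      intro 𝔪 h𝔪
      by_cases hfm : f ∈ 𝔪
      · exact Or.inl ⟨h𝔪, hfm⟩
      · exact Or.inr ⟨h𝔪, hfm⟩
    intro hfin3
    exact hinf ((h2.union hfin3).subset hsub)
  haveI : Infinite {𝔪 : Ideal R // 𝔪.IsMaximal ∧ f ∉ 𝔪} := Set.infinite_coe_iff.mpr h3
  have hinf' : (Set.range pt).Infinite := Set.infinite_range_of_injective hpt_inj
  -- (6) the section `s` agrees with the unit section on each of these field points
  apply Over.OverMorphism.ext
  refine Spec.sections_ext_of_infinite_fieldPoints 𝒜.X.hom s.left (1 : 𝟙_ _ ⟶ 𝒜.X).left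
    (Over.w s) (Over.w _) (Set.range pt) hinf' ?_
  rintro _ ⟨𝔪, rfl⟩
  haveI : 𝔪.1.IsMaximal := 𝔪.2.1
  letI : Field (R ⧸ 𝔪.1) := Ideal.Quotient.field 𝔪.1
  -- the field point `φ : Spec (R ⧸ 𝔪) → Spec R[1/f]` hits `pt 𝔪`
  let φ : Spec (.of (R ⧸ 𝔪.1)) ⟶ Spec (.of (Localization.Away f)) :=
    Spec.map (CommRingCat.ofHom (IsLocalization.Away.lift f (hunit 𝔪)))
  have hφpt : φ (IsLocalRing.closedPoint (R ⧸ 𝔪.1)) = pt 𝔪 := by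
    apply PrimeSpectrum.ext
    change (PrimeSpectrum.comap _ (IsLocalRing.closedPoint (R ⧸ 𝔪.1))).asIdeal = _
    rw [PrimeSpectrum.comap_asIdeal]
    change (IsLocalRing.maximalIdeal (R ⧸ 𝔪.1)).comap (IsLocalization.Away.lift f (hunit 𝔪)) = _
    rw [IsLocalRing.maximalIdeal_eq_bot, ← RingHom.ker_eq_comap_bot]
  refine ⟨R ⧸ 𝔪.1, inferInstance, φ, hφpt, ?_⟩
  -- reduction of `s` at `𝔪`: a divisible point of a proper group scheme over the MLF `R ⧸ 𝔪`
  haveI : Module.Finite ℚ_[p] (R ⧸ 𝔪.1) := hfin 𝔪.1 𝔪.2.1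
  haveI : IsProper ((Over.pullback φ).obj 𝒜.X).hom := isProper_pullback_obj_hom φ
  apply comp_left_eq_one_of_reduction_eq_one φ s
  exact AlgPoints.eq_one_of_forall_exists_pow_eq_of_finite_padic p (R ⧸ 𝔪.1)
    ((Over.pullback φ).obj 𝒜.X) _ (exists_pow_reduction_eq φ s hs)

/-- **[AbsTopIII] Rmk. 1.5.4 (i) at transcendence degree one — condition (a) of Def. 1.5 for every
abelian variety over every finite extension `L` of `ℚ_p(t)`**: `⋂_{N ≥ 1} N · A(L) = {0}`, by
`divisibleElementsTrivial_points_of_dedekind_padic` for the integral closure `R` of `ℚ_p[t]` in `L`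
(Dedekind with fraction field `L`, infinitely many maximal ideals, residue fields finite over `ℚ_p`:
companion `KummerFaithfulCurveDedekindProofs`). [cite: MochizukiAbsTopIII2015, Rmk 1.5.4 (i) p.33] -/
theorem divisibleElementsTrivial_points_of_finite_ratFunc_padic (p : ℕ) [Fact p.Prime] (L : Type)
    [Field L] [Algebra ℚ_[p][X] L] [Algebra (RatFunc ℚ_[p]) L] [IsScalarTower ℚ_[p][X] (RatFunc ℚ_[p]) L]
    [FiniteDimensional (RatFunc ℚ_[p]) L] [Algebra ℚ_[p] L] [IsScalarTower ℚ_[p] ℚ_[p][X] L]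
    (A : AbelianVariety L) : DivisibleElementsTrivial (A.Points L) := by
  haveI : Algebra.IsSeparable (RatFunc ℚ_[p]) L := Algebra.IsAlgebraic.isSeparable_of_perfectField
  haveI : Infinite ℚ_[p] := infinite_padic p
  haveI : IsDedekindDomain (integralClosure ℚ_[p][X] L) :=
    isDedekindDomain_integralClosure_polynomial
  haveI : IsFractionRing (integralClosure ℚ_[p][X] L) L :=
    isFractionRing_integralClosure_polynomial
  exact divisibleElementsTrivial_points_of_dedekind_padic p (integralClosure ℚ_[p][X] L) L
    infinite_setOf_isMaximal_integralClosure_polynomial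
    (fun 𝔪 h𝔪 => by haveI := h𝔪; exact finite_quotient_integralClosure_polynomial 𝔪) A

end Literature.AnabelianGeometry.AbsoluteAnabelian.AbsTopIII
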